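import Summits.BirchSwinnertonDyer.BirchSwinnertonDyer.Theorems.QuadraticBranchSignedControlPlusEtaNonsurjCartanFieldLine
import Summits.BirchSwinnertonDyer.BirchSwinnertonDyer.Theorems.QuadraticBranchSignedControlPlusEtaNonsurjCartanFieldFrobenius
import Literature.NumberTheory.EllipticCurves.CMTorsionIrreducibleOrdinaryProofs
import Literature.NumberTheory.EllipticCurves.ZywinaCMImageProofs
import HarnessLib

/-!
# Route `QuadraticBranchSignedControl` (rung K8, cell `bsd-potss`): crux stmt-BirchSwinnertonDyer-19606
# `PlusEtaMainConjectureNonsurj` — THE CM TWISTING CHARACTER IS THE CARTAN CHARACTER: for a CM row, and for every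
# CM-CURVE anchor of a row, `H = ker χ` with `χ` the quadratic character twisting a CM endomorphism `√D` — NO displayed
# `(Ψ, χ)` hypothesis any more (k8eta-c2 g9's `…CartanFieldCMAnchor` made unconditional by the tree's CM theory)

WHAT. g9's `…CartanFieldCMAnchor` proved «a CM anchor `A` of a row `V` forces `H_V = ker χ`» under the DISPLAYED CM input
`(Ψ ≠ 0, χ ≠ 1, Ψ(σP) = χ(σ)·σΨ(P))` on `A[p]`. The tree's CM library supplies exactly this input from `A.HasCM` alone:
`WeierstrassCurve.exists_sqrt_twist_apply_ne_zero_of_hasCM` (Lang, Ch. 10 §4 Remark, proved structurally in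
`CMTorsionGaloisImageProofs`: a CM endomorphism `ψ` with `ψ² = D < 0` is conjugated by `σ ∈ Γ_ℚ` to `χ(σ)ψ` for a
non-trivial quadratic character `χ` — the character of the CM field `ℚ(√D)` —, made VISIBLE on `A[p]` by the `p`-descent of
`CMTorsionIrreducibleOrdinaryProofs`) and `exists_restrict_geomTorsion_of_twist` (restriction to `A[p]`). Hence:

* §1 `centralizes_sq_iff_twistChar_eq_one`: for ANY curve `A` with image `C_ns⁺(p)` (`p ≠ 2`) and any twisted endomorphism
  `ψ` of `A(ℚ̄)` (`ψ(σP) = χ(σ)·σψ(P)`, `χ ≠ 1`) visible on `A[p]`: `σ ∈ H_A ⟺ χ(σ) = 1`. In particular the twisting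
  character of a visible datum is UNIQUE (`twistChar_eq_of_visible`).
* §2 **CM rows** `exists_cmTwistChar_iff_centralizes_sq_of_hasCM_of_row`: for `A/ℚ` globally minimal WITH CM, `p ≥ 5` good,
  `a_p(A) = 0` (a CM row of 19606 — its tower is never onto, `not_hasSurjectiveModNGaloisRep_of_hasCM`): there are `ψ`,
  `D < 0` (`ψ² = D`) and `χ ≠ 1` twisting `ψ` with **`H_A = ker χ`** — the Cartan field of a CM row IS its CM field `ℚ(√D)`
  (FINDING-g5 §2 (c), now a kernel theorem with no displayed input).
* §3 **CM-curve anchors** `exists_cmTwistChar_iff_centralizes_sq_of_cmAnchor_of_row`: if a row `V` is mod-`p` congruent to a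
  curve `A` WITH CM (no further hypothesis on `A`: its image is `C_ns⁺(p)` by congruence invariance), then for the CM twisting
  character `χ` of `A`: `H_V = ker χ`, and (with `…CartanFieldInert` / `…CartanFieldImaginary`) `χ` kills every inertia group
  above `p` and above the good and multiplicative places of `V`, equals `−1` on some element of every decomposition group
  above `p`, and on complex conjugation: **the CM field `ℚ(√D)` of a CM-curve anchor is imaginary (of course), unramified at
  `p` and outside `N_add(V)`, with `p` INERT** — g5's list at `p = 5` by structure, hypothesis-free. Contrapositive
  certificate `not_modPCongruent_of_hasCM_of_twistChar`: one `σ` on which `H_V` and `ker χ_A` disagree excludes the anchor.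

HONEST FRAMING (cell `bsd-potss`, run/shared/lean/pub/bsd-potss/; FULL-BSD rank ≤ 1 programme): TOOL THEOREMS ONLY (no definition,
no named fact, no `sorry`, axioms standard). What is NOT proved: that `ker χ` is `Γ_{ℚ(√D)}` for the displayed integer `D`
as a statement about `√D ∈ ℚ̄` (the tree phrases Lang's Remark through `χ`; the identification is the content of the Remark and
is not re-derived on elements of `ℚ̄`). Nothing is booked; crux 19606 stays OPEN; `BSD(W, p)` is claimed for no pair.
Seat `bsd-potss-k8eta-c2` g10 (prover), `--supports stmt-BirchSwinnertonDyer-19606`.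

References: [Lang1987] Ch. 10 §4 (Remark, Thm. 8); [Serre1972] §2.2, §4.5; [SilvermanAEC2009] §VIII.2; [Zywina2015] §1.9.
-/

set_option autoImplicit false
set_option linter.dupNamespace false

noncomputable section

open scoped Classical NumberField Pointwise

open Matrix Field IsDedekindDomain NumberField WeierstrassCurve Literature.NumberTheory.EllipticCurves
  Literature.NumberTheory.SerreUniformity Literature.NumberTheory.EllipticCurves.Rank1Residual Rat.HeightOneSpectrum
open Summit.BirchSwinnertonDyer.Rank1Residual.O6 (ModPCongruent)

namespace Summit.BirchSwinnertonDyer.BirchSwinnertonDyer.Theorems.EtaCartanField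

variable {p : ℕ} [hp : Fact p.Prime]

/-! ## §1 A visible twisted endomorphism pins the Cartan subgroup to `ker χ` -/

/-- Pointwise square ⟹ operator square (bookkeeping). [folklore] -/
private theorem mul_self_eq_intCast_of_apply {A : WeierstrassCurve ℚ} {ψ : AddMonoid.End A.geomPoints} {D : ℤ}
    (hψψ : ∀ P : A.geomPoints, ψ (ψ P) = D • P) : ψ * ψ = (D : AddMonoid.End A.geomPoints) := by
  refine AddMonoidHom.ext fun P => ?_
  change ψ (ψ P) = (D : AddMonoid.End A.geomPoints) P
  rw [AddMonoid.End.intCast_apply]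
  exact hψψ P

/-- **A visible twisted endomorphism pins the Cartan subgroup.** Let `A/ℚ` have image `C_ns⁺(p)` (`p ≠ 2`), and let `ψ` be
an additive endomorphism of `A(ℚ̄)` with `ψ² = D`, twisted by a non-trivial quadratic character `χ` (`ψ(σP) = χ(σ)·σψ(P)`) and
VISIBLE on `A[p]` (`ψ(P₀) ≠ 0` for some `P₀ ∈ A[p]`). Then `σ` centralises the squares on `A[p]` iff `χ(σ) = 1`: **`H_A = ker χ`**.
(Restrict `ψ` to `A[p]` — `exists_restrict_geomTorsion_of_twist` — and apply g9's `centralizes_sq_iff_chi_eq_one`.)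
[cite: Lang1987, Ch. 10 §4, Remark] [cite: Serre1972, §2.2] -/
theorem centralizes_sq_iff_twistChar_eq_one {A : WeierstrassCurve ℚ} [A.IsElliptic] (hp2 : p ≠ 2)
    (hA : HasModPImageEqNonsplitCartanNormalizer A p) {ψ : AddMonoid.End A.geomPoints} {D : ℤ}
    (hψψ : ∀ P : A.geomPoints, ψ (ψ P) = D • P) {χ : absoluteGaloisGroup ℚ →* ℤˣ}
    (hχ : ∃ σ : absoluteGaloisGroup ℚ, χ σ ≠ 1)
    (hrel : ∀ (σ : absoluteGaloisGroup ℚ) (P : A.geomPoints), ψ (σ • P) = ((χ σ : ℤˣ) : ℤ) • σ • ψ P)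
    (hvis : ∃ P₀ : A.geomPoints, (p : ℤ) • P₀ = 0 ∧ ψ P₀ ≠ 0) (σ : absoluteGaloisGroup ℚ) :
    (∀ (τ : absoluteGaloisGroup ℚ) (P : A.geomTorsion p), σ • ((τ * τ) • P) = (τ * τ) • (σ • P)) ↔ χ σ = 1 := by
  obtain ⟨Ψ, hΨcoe, -, hΨrel⟩ := exists_restrict_geomTorsion_of_twist A (mul_self_eq_intCast_of_apply hψψ) hrel p
  obtain ⟨P₀, hP₀p, hP₀⟩ := hvis
  have hP₀mem : P₀ ∈ A.geomTorsion p := by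
    rwa [Submodule.mem_toAddSubgroup, Submodule.mem_torsionBy_iff]
  have hΨ0 : Ψ ≠ 0 := fun h => hP₀ (by rw [← hΨcoe ⟨P₀, hP₀mem⟩, h]; rfl)
  exact centralizes_sq_iff_chi_eq_one hp2 hA χ hχ Ψ hΨ0 hΨrel σ

/-- **Uniqueness of the twisting character.** Two visible twisted endomorphisms of a curve with image `C_ns⁺(p)` (`p ≠ 2`)
have the SAME quadratic character (both are the Cartan character `χ_A`). [cite: Lang1987, Ch. 10 §4, Remark] -/
theorem twistChar_eq_of_visible {A : WeierstrassCurve ℚ} [A.IsElliptic] (hp2 : p ≠ 2)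
    (hA : HasModPImageEqNonsplitCartanNormalizer A p) {ψ ψ' : AddMonoid.End A.geomPoints} {D D' : ℤ}
    (hψψ : ∀ P : A.geomPoints, ψ (ψ P) = D • P) (hψψ' : ∀ P : A.geomPoints, ψ' (ψ' P) = D' • P)
    {χ χ' : absoluteGaloisGroup ℚ →* ℤˣ} (hχ : ∃ σ : absoluteGaloisGroup ℚ, χ σ ≠ 1)
    (hχ' : ∃ σ : absoluteGaloisGroup ℚ, χ' σ ≠ 1)
    (hrel : ∀ (σ : absoluteGaloisGroup ℚ) (P : A.geomPoints), ψ (σ • P) = ((χ σ : ℤˣ) : ℤ) • σ • ψ P)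
    (hrel' : ∀ (σ : absoluteGaloisGroup ℚ) (P : A.geomPoints), ψ' (σ • P) = ((χ' σ : ℤˣ) : ℤ) • σ • ψ' P)
    (hvis : ∃ P₀ : A.geomPoints, (p : ℤ) • P₀ = 0 ∧ ψ P₀ ≠ 0)
    (hvis' : ∃ P₀ : A.geomPoints, (p : ℤ) • P₀ = 0 ∧ ψ' P₀ ≠ 0) : χ = χ' := by
  refine MonoidHom.ext fun σ => ?_
  have h1 := centralizes_sq_iff_twistChar_eq_one hp2 hA hψψ hχ hrel hvis σ
  have h2 := centralizes_sq_iff_twistChar_eq_one hp2 hA hψψ' hχ' hrel' hvis' σ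
  rcases Int.units_eq_one_or (χ σ) with hc | hc <;> rcases Int.units_eq_one_or (χ' σ) with hc' | hc'
  · rw [hc, hc']
  · exact absurd (h2.mp (h1.mpr hc)) (by rw [hc']; decide)
  · exact absurd (h1.mp (h2.mpr hc')) (by rw [hc]; decide)
  · rw [hc, hc']

/-! ## §2 CM rows: the Cartan field is the CM field -/

/-- **A CM curve at a good supersingular odd prime has image exactly `C_ns⁺(p)`** (`A/ℚ` globally minimal with CM, `p ≠ 2` good,
`p ∣ a_p`): CM curves are never onto mod `p` (`not_hasSurjectiveModNGaloisRep_of_hasCM`, Zywina §1.9), and the exact-image theorem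
at a good supersingular prime applies. [cite: Zywina2015, §1.9 (Prop. 1.14, 1.16)] [cite: Serre1972, §2.7 Prop. 17] -/
theorem hasModPImageEqNonsplitCartanNormalizer_of_hasCM (A : WeierstrassCurve ℚ) [A.IsElliptic] [A.IsGloballyMinimal]
    (hp2 : p ≠ 2) (hCM : A.HasCM) (hgood : A.HasGoodReductionAtPrime p) (hap : (p : ℤ) ∣ A.frobeniusTrace p) :
    HasModPImageEqNonsplitCartanNormalizer A p :=
  Rank1Residual.GaloisImage.hasModPImageEqNonsplitCartanNormalizer_of_goodSS_of_not_surj A p hp2 ⟨hgood, hap⟩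
    (A.not_hasSurjectiveModNGaloisRep_of_hasCM hCM hp.out hp2)

/-- **The Cartan subgroup of a CM row is the kernel of its CM twisting character** (FINDING-19606-k8eta-c2-g5 §2 (c) as a kernel
theorem, hypothesis-free). For `A/ℚ` globally minimal WITH CM and `p ≠ 2` good with `p ∣ a_p(A)` (so, at `p ≥ 5`, `a_p = 0`: a CM
row of crux 19606) there are an additive endomorphism `ψ` of `A(ℚ̄)`, an integer `D < 0` with `ψ² = D`, and a non-trivial
quadratic character `χ` with `ψ(σP) = χ(σ)·σψ(P)` — the character of the CM field `ℚ(√D)` twisting the CM endomorphism `√D`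
(Lang's Remark; the tree's `exists_sqrt_twist_apply_ne_zero_of_hasCM`) — such that for every `σ ∈ Γ_ℚ`:
`σ` centralises the squares on `A[p]` iff `χ(σ) = 1`. So the Cartan field `K_A` of a CM row is its CM field.
[cite: Lang1987, Ch. 10 §4, Remark and Thm. 8] [cite: Serre1972, §4.5] -/
theorem exists_cmTwistChar_iff_centralizes_sq_of_hasCM (A : WeierstrassCurve ℚ) [A.IsElliptic] [A.IsGloballyMinimal]
    (hp2 : p ≠ 2) (hCM : A.HasCM) (hgood : A.HasGoodReductionAtPrime p) (hap : (p : ℤ) ∣ A.frobeniusTrace p) :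
    ∃ (ψ : AddMonoid.End A.geomPoints) (D : ℤ) (χ : absoluteGaloisGroup ℚ →* ℤˣ),
      D < 0 ∧ (∀ P : A.geomPoints, ψ (ψ P) = D • P) ∧ (∃ σ : absoluteGaloisGroup ℚ, χ σ ≠ 1) ∧
      (∀ (σ : absoluteGaloisGroup ℚ) (P : A.geomPoints), ψ (σ • P) = ((χ σ : ℤˣ) : ℤ) • σ • ψ P) ∧
      (∃ P₀ : A.geomPoints, (p : ℤ) • P₀ = 0 ∧ ψ P₀ ≠ 0) ∧
      ∀ σ : absoluteGaloisGroup ℚ, χ σ = 1 ↔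
        ∀ (τ : absoluteGaloisGroup ℚ) (P : A.geomTorsion p), σ • ((τ * τ) • P) = (τ * τ) • (σ • P) := by
  obtain ⟨ψ, D, χ, hD, hψψ, hχ, hrel, hvis⟩ := A.exists_sqrt_twist_apply_ne_zero_of_hasCM hCM hp.out
  have hA := hasModPImageEqNonsplitCartanNormalizer_of_hasCM A hp2 hCM hgood hap
  exact ⟨ψ, D, χ, hD, hψψ, hχ, hrel, hvis, fun σ =>
    (centralizes_sq_iff_twistChar_eq_one hp2 hA hψψ hχ hrel hvis σ).symm⟩

/-- **Row form** (`p ≥ 5`, `a_p = 0`): on a CM row of crux 19606 the Cartan subgroup is `ker χ` for the CM twisting character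
`χ`, and (by `…CartanFieldInert` / `…CartanFieldImaginary`) this `χ` is unramified at `p` and at the good and multiplicative places,
takes the value `−1` on an element of every decomposition group above `p`, and on complex conjugation: the CM field has `p`
INERT and is unramified outside `N_add(A)` (Deuring's criterion, here recovered on `A[p]`). [cite: Lang1987, Ch. 10 §4]
[cite: Serre1972, §1.11 Prop. 12 d), §4.5] -/
theorem exists_cmTwistChar_local_of_hasCM_of_row (A : WeierstrassCurve ℚ) [A.IsElliptic] [A.IsGloballyMinimal]
    (hp5 : 5 ≤ p) (hCM : A.HasCM) (hgood : A.HasGoodReductionAtPrime p) (hap : A.frobeniusTrace p = 0) :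
    ∃ (ψ : AddMonoid.End A.geomPoints) (D : ℤ) (χ : absoluteGaloisGroup ℚ →* ℤˣ),
      D < 0 ∧ (∀ P : A.geomPoints, ψ (ψ P) = D • P) ∧ (∃ σ : absoluteGaloisGroup ℚ, χ σ ≠ 1) ∧
      (∀ (σ : absoluteGaloisGroup ℚ) (P : A.geomPoints), ψ (σ • P) = ((χ σ : ℤˣ) : ℤ) • σ • ψ P) ∧
      (∀ σ : absoluteGaloisGroup ℚ, χ σ = 1 ↔
        ∀ (τ : absoluteGaloisGroup ℚ) (P : A.geomTorsion p), σ • ((τ * τ) • P) = (τ * τ) • (σ • P)) ∧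
      (∀ v : HeightOneSpectrum (𝓞 ℚ),
        ((p : 𝓞 ℚ) ∈ v.asIdeal ∨ A.HasGoodReductionAt v ∨ A.HasMultiplicativeReductionAt v) →
        ∀ 𝔔 ∈ v.primesAbove, ∀ σ ∈ 𝔔.inertia (absoluteGaloisGroup ℚ), χ σ = 1) ∧
      (∀ v : HeightOneSpectrum (𝓞 ℚ), (primesEquiv v : ℕ) = p →
        ∀ 𝔓 ∈ v.primesAbove, ∃ φ ∈ MulAction.stabilizer (absoluteGaloisGroup ℚ) 𝔓, χ φ = -1) ∧
      (∀ σ : absoluteGaloisGroup ℚ, (∀ P : A.geomTorsion p, σ • (σ • P) = P) →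
        (∀ t : AlgebraicClosure ℚ, t ^ p = 1 → σ • t = t⁻¹) → χ σ = -1) := by
  have hp2 : p ≠ 2 := by omega
  have hns : ¬ ∀ m : ℕ, A.HasSurjectiveModNGaloisRep (p ^ m : ℕ) := fun h =>
    A.not_hasSurjectiveModNGaloisRep_of_hasCM hCM hp.out hp2 (by simpa using h 1)
  obtain ⟨ψ, D, χ, hD, hψψ, hχ, hrel, -, hiff⟩ :=
    exists_cmTwistChar_iff_centralizes_sq_of_hasCM A hp2 hCM hgood (by rw [hap]; exact dvd_zero _)
  have hneg : ∀ σ, χ σ ≠ 1 → χ σ = -1 := fun σ hσ => (Int.units_eq_one_or (χ σ)).resolve_left hσ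
  refine ⟨ψ, D, χ, hD, hψψ, hχ, hrel, hiff, fun v hv 𝔔 h𝔔 σ hσ => ?_, fun v hv 𝔓 h𝔓 => ?_, fun σ hσσ hinv => ?_⟩
  · exact (hiff σ).mpr (inertia_centralizes_sq_of_row A p hp5 hgood hap hns hv h𝔔 hσ)
  · obtain ⟨φ, hφ, hnot⟩ := forall_exists_frob_not_centralizes_sq_of_row A p hp5 hgood hap hns hv h𝔓
    exact ⟨φ, hφ, hneg φ (fun h1 => hnot ((hiff φ).mp h1))⟩
  · exact hneg σ (fun h1 =>
      not_centralizes_sq_of_inverts_rootsOfUnity_of_row A p hp5 hgood hap hns hσσ hinv ((hiff σ).mp h1))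

/-! ## §3 CM-curve anchors of a row: the CM character is the Cartan character of the row -/

/-- **A CM-curve anchor pins `H_V` to the kernel of its CM character — hypothesis-free.** Let `V` be a row of crux 19606 and
`A/ℚ` ANY elliptic curve WITH CM which is mod-`p` congruent to `V` (`ModPCongruent V A p`; then `Im ρ̄_{A,p} = C_ns⁺(p)` by
congruence invariance). For every twisted endomorphism `ψ` of `A(ℚ̄)` (character `χ ≠ 1`) visible on `A[p]` — such exist by
`exists_sqrt_twist_apply_ne_zero_of_hasCM` —: `σ ∈ H_V ⟺ χ(σ) = 1`. [cite: Lang1987, Ch. 10 §4, Remark] [cite: Serre1972, §4.5] -/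
theorem centralizes_sq_iff_twistChar_eq_one_of_cmAnchor_of_row (V : WeierstrassCurve ℚ) [V.IsElliptic] [V.IsGloballyMinimal]
    (p : ℕ) [Fact p.Prime] (hp5 : 5 ≤ p) (hgood : V.HasGoodReductionAtPrime p) (hap : V.frobeniusTrace p = 0)
    (hns : ¬ ∀ m : ℕ, V.HasSurjectiveModNGaloisRep (p ^ m : ℕ)) {A : WeierstrassCurve ℚ} [A.IsElliptic]
    (hVA : ModPCongruent V A p) {ψ : AddMonoid.End A.geomPoints} {D : ℤ} (hψψ : ∀ P : A.geomPoints, ψ (ψ P) = D • P)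
    {χ : absoluteGaloisGroup ℚ →* ℤˣ} (hχ : ∃ σ : absoluteGaloisGroup ℚ, χ σ ≠ 1)
    (hrel : ∀ (σ : absoluteGaloisGroup ℚ) (P : A.geomPoints), ψ (σ • P) = ((χ σ : ℤˣ) : ℤ) • σ • ψ P)
    (hvis : ∃ P₀ : A.geomPoints, (p : ℤ) • P₀ = 0 ∧ ψ P₀ ≠ 0) (σ : absoluteGaloisGroup ℚ) :
    (∀ (τ : absoluteGaloisGroup ℚ) (P : V.geomTorsion p), σ • ((τ * τ) • P) = (τ * τ) • (σ • P)) ↔ χ σ = 1 := by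
  have hp2 : p ≠ 2 := by omega
  have hA : HasModPImageEqNonsplitCartanNormalizer A p :=
    hasModPImageEqNonsplitCartanNormalizer_of_modPCongruent
      (hasModPImageEqNonsplitCartanNormalizer_of_row V p hp5 hgood hap hns) hVA
  rw [centralizes_sq_iff_of_modPCongruent hVA σ]
  exact centralizes_sq_iff_twistChar_eq_one hp2 hA hψψ hχ hrel hvis σ

/-- **Certificate (no CM-curve anchor), hypothesis-free form**: a CM curve `A` with a visible twisted endomorphism of character
`χ`, and ONE `σ ∈ Γ_ℚ` on which «`σ ∈ H_V`» and «`χ(σ) = 1`» disagree, is NOT mod-`p` congruent to the row `V`.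
[cite: Serre1972, §4.5] -/
theorem not_modPCongruent_of_hasCM_of_twistChar (V : WeierstrassCurve ℚ) [V.IsElliptic] [V.IsGloballyMinimal]
    (p : ℕ) [Fact p.Prime] (hp5 : 5 ≤ p) (hgood : V.HasGoodReductionAtPrime p) (hap : V.frobeniusTrace p = 0)
    (hns : ¬ ∀ m : ℕ, V.HasSurjectiveModNGaloisRep (p ^ m : ℕ)) {A : WeierstrassCurve ℚ} [A.IsElliptic]
    {ψ : AddMonoid.End A.geomPoints} {D : ℤ} (hψψ : ∀ P : A.geomPoints, ψ (ψ P) = D • P)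
    {χ : absoluteGaloisGroup ℚ →* ℤˣ} (hχ : ∃ σ : absoluteGaloisGroup ℚ, χ σ ≠ 1)
    (hrel : ∀ (σ : absoluteGaloisGroup ℚ) (P : A.geomPoints), ψ (σ • P) = ((χ σ : ℤˣ) : ℤ) • σ • ψ P)
    (hvis : ∃ P₀ : A.geomPoints, (p : ℤ) • P₀ = 0 ∧ ψ P₀ ≠ 0) {σ : absoluteGaloisGroup ℚ}
    (hσ : ¬ ((∀ (τ : absoluteGaloisGroup ℚ) (P : V.geomTorsion p), σ • ((τ * τ) • P) = (τ * τ) • (σ • P)) ↔ χ σ = 1)) :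
    ¬ ModPCongruent V A p := fun hVA =>
  hσ (centralizes_sq_iff_twistChar_eq_one_of_cmAnchor_of_row V p hp5 hgood hap hns hVA hψψ hχ hrel hvis σ)

/-- **The CM field of a CM-curve anchor: `p` inert, unramified outside `N_add(V)`, imaginary — hypothesis-free.** Let `V` be a
row of crux 19606 and `A/ℚ` an elliptic curve WITH CM, mod-`p` congruent to `V`. Then for the CM twisting datum
`(ψ, D < 0, χ ≠ 1)` of `A` (Lang's Remark): `H_V = ker χ`; `χ` kills the inertia of every prime of `ℤ̄` above `p`, above every
good place and above every multiplicative place of `V`; above every `𝔓 ∣ p` some `φ ∈ Stab(𝔓)` has `χ(φ) = −1`; and every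
involution of `V[p]` inverting `μ_p` has `χ = −1`. At `p = 5`: the CM field of a CM-curve anchor is one of the class-number-one
fields with `5` inert — `ℚ(√−2), ℚ(√−3), ℚ(√−7), ℚ(√−43), ℚ(√−67), ℚ(√−163)` — with discriminant supported on the additive
primes of `V` (FINDING-g5 §2 (c)–(g) by structure; FINDING-g10: every row nevertheless has a CM-NEWFORM anchor).
[cite: Lang1987, Ch. 10 §4, Remark] [cite: Serre1972, §1.11 Prop. 12 d), §4.5] -/
theorem exists_cmTwistChar_local_of_cmAnchor_of_row (V : WeierstrassCurve ℚ) [V.IsElliptic] [V.IsGloballyMinimal]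
    (p : ℕ) [Fact p.Prime] (hp5 : 5 ≤ p) (hgood : V.HasGoodReductionAtPrime p) (hap : V.frobeniusTrace p = 0)
    (hns : ¬ ∀ m : ℕ, V.HasSurjectiveModNGaloisRep (p ^ m : ℕ)) {A : WeierstrassCurve ℚ} [A.IsElliptic] (hCM : A.HasCM)
    (hVA : ModPCongruent V A p) :
    ∃ (ψ : AddMonoid.End A.geomPoints) (D : ℤ) (χ : absoluteGaloisGroup ℚ →* ℤˣ),
      D < 0 ∧ (∀ P : A.geomPoints, ψ (ψ P) = D • P) ∧ (∃ σ : absoluteGaloisGroup ℚ, χ σ ≠ 1) ∧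
      (∀ (σ : absoluteGaloisGroup ℚ) (P : A.geomPoints), ψ (σ • P) = ((χ σ : ℤˣ) : ℤ) • σ • ψ P) ∧
      (∀ σ : absoluteGaloisGroup ℚ, χ σ = 1 ↔
        ∀ (τ : absoluteGaloisGroup ℚ) (P : V.geomTorsion p), σ • ((τ * τ) • P) = (τ * τ) • (σ • P)) ∧
      (∀ v : HeightOneSpectrum (𝓞 ℚ),
        ((p : 𝓞 ℚ) ∈ v.asIdeal ∨ V.HasGoodReductionAt v ∨ V.HasMultiplicativeReductionAt v) →
        ∀ 𝔔 ∈ v.primesAbove, ∀ σ ∈ 𝔔.inertia (absoluteGaloisGroup ℚ), χ σ = 1) ∧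
      (∀ v : HeightOneSpectrum (𝓞 ℚ), (primesEquiv v : ℕ) = p →
        ∀ 𝔓 ∈ v.primesAbove, ∃ φ ∈ MulAction.stabilizer (absoluteGaloisGroup ℚ) 𝔓, χ φ = -1) ∧
      (∀ σ : absoluteGaloisGroup ℚ, (∀ P : V.geomTorsion p, σ • (σ • P) = P) →
        (∀ t : AlgebraicClosure ℚ, t ^ p = 1 → σ • t = t⁻¹) → χ σ = -1) := by
  have hpp : p.Prime := Fact.out
  obtain ⟨ψ, D, χ, hD, hψψ, hχ, hrel, hvis⟩ := A.exists_sqrt_twist_apply_ne_zero_of_hasCM hCM hpp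
  have hiff : ∀ σ : absoluteGaloisGroup ℚ, χ σ = 1 ↔
      ∀ (τ : absoluteGaloisGroup ℚ) (P : V.geomTorsion p), σ • ((τ * τ) • P) = (τ * τ) • (σ • P) := fun σ =>
    (centralizes_sq_iff_twistChar_eq_one_of_cmAnchor_of_row V p hp5 hgood hap hns hVA hψψ hχ hrel hvis σ).symm
  have hneg : ∀ σ, χ σ ≠ 1 → χ σ = -1 := fun σ hσ => (Int.units_eq_one_or (χ σ)).resolve_left hσ
  refine ⟨ψ, D, χ, hD, hψψ, hχ, hrel, hiff, fun v hv 𝔔 h𝔔 σ hσ => ?_, fun v hv 𝔓 h𝔓 => ?_, fun σ hσσ hinv => ?_⟩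
  · exact (hiff σ).mpr (inertia_centralizes_sq_of_row V p hp5 hgood hap hns hv h𝔔 hσ)
  · obtain ⟨φ, hφ, hnot⟩ := forall_exists_frob_not_centralizes_sq_of_row V p hp5 hgood hap hns hv h𝔓
    exact ⟨φ, hφ, hneg φ (fun h1 => hnot ((hiff φ).mp h1))⟩
  · exact hneg σ (fun h1 =>
      not_centralizes_sq_of_inverts_rootsOfUnity_of_row V p hp5 hgood hap hns hσσ hinv ((hiff σ).mp h1))

end Summit.BirchSwinnertonDyer.BirchSwinnertonDyer.Theorems.EtaCartanField

end
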